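import Literature.IUT.HodgeArakelov.PlusMinusTowerCoverModel

/-!
# B14 API: the printed subgroups `Π_v ⊆ Π^±_v ⊆ Π̂^cor_v` and `Δ̂^cor_v` of the landed tower `PlusMinusTower.ofCoverModel` / `ofPiCHat`, computed

S. Mochizuki, *Inter-universal Teichmüller theory II*, kurims manuscript (Dec. 2020), §2, Def. 2.3 (i) p. 67 ([IUTchII] Def 2.3 (i), kurims p.67)
[claim: Mochizuki2012, status: disputed] (D-0012 claim key; series status DISPUTED — bookkeeping over the landed construction p430122; nothing of
the series is asserted).  abc-iut cell, seat abc-iut-L6-t19 gen 5 (B14).  PROOF-ONLY (0 defs).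

For abc-iut-L6-t1's abbreviations `W.piV = (emb ∘ incl)(P)` ("`Π_v`"), `W.piPM = emb(Π^tp_{X_v}(P))` ("`Π^±_v`"), `W.deltaCorHat = Ker aug`
("`Δ̂^cor_v`") at `W := ofCoverModel …` (any injective completion `ι`, any augmentation `Φ`) and at the tower of record `W := ofPiCHat …`:
`Π^±_v = ι(inclX Π^tp_X̲)`, `Π_v = ι(inclX Π^tp_X̲̲)`, `Δ̂^cor_v = Ker Φ`, and `Π̂^±_v`, `Π̂_v` ARE the closures of `Π^±_v`, `Π_v` — the printed
"`Π̂` = profinite completion (closure)" relations, PROVED for the construction.  Nothing here takes a side on [IUTchIII] Cor. 3.12; typed ≠ proved.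
-/

namespace Literature.IUT.HodgeArakelov

open Literature.AnabelianGeometry.EtaleTheta Literature.AnabelianGeometry.SemiGraphs

namespace PlusMinusTower

variable {p : ℕ} [Fact p.Prime] {M : MuTwoSetting p} (e : M.CLevelData)
  {E : M.toThetaSetting.EtaleThetaData} {l : ℕ} (C : E.DoubleUnderline l) {N : ℕ+}
  (μ : M.toThetaSetting.CyclotomeMod l N) (hC : M.toThetaSetting.Compat) (hS : M.toThetaSetting.Sec2Hyps)
  (hl : l.Prime) (hp2 : p ≠ 2) (hpl : p ≠ l) (hζ : ∃ ζ : M.toThetaSetting.K, IsPrimitiveRoot ζ (4 * l))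
  {η : (C.thetaEnvData μ hC hS).PiYdd → MuN p N} (hη : η ∈ (C.thetaEnvData μ hC hS).thetaCocycles)
  {Q : Type} [Group Q] [TopologicalSpace Q] [IsTopologicalGroup Q]
  (ι : M.GtpC →ₜ* Q) (hι : IsProfiniteCompletion ι) (hinj : Function.Injective ι)
  (Φ : Q →* GQp p) (hΦ : ∀ g : M.GtpC, Φ (ι g) = e.augC g) (hΦK : Φ.range = M.GK)
  (hZ : Thm16Sub.KerToZIsCompactlyGenerated M.toThetaSetting) (hN : (C.Huu.subgroupOf (M.GtpXu l)).Normal)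
  {P : TopGroup.{0}} (T : TemperedCoverings (BadPlaceSetting.ofUnderline C μ hC hS hl hp2 hpl hζ hη) P)

omit [IsTopologicalGroup Q] in
/-- The range of the embedding of the construction is `ι(inclX Π^tp_X̲)` (`plainIso` is onto).
([IUTchII] Def 2.3 (i), kurims p.67) [claim: Mochizuki2012, status: disputed] -/
theorem range_coverModelEmb :
    (coverModelEmb C μ hC hS hl hp2 hpl hζ hη ι T).range = ((M.GtpXu l).map M.inclX).map ι.toMonoidHom := by
  rw [coverModelEmb, MonoidHom.range_comp, MonoidHom.range_eq_top.mpr T.plainIso.surjective, ← MonoidHom.range_eq_map,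
    MonoidHom.range_comp, Subgroup.range_subtype, Subgroup.map_map]

omit [IsTopologicalGroup Q] in
/-- The embedding of the construction composed with `incl` is `ι ∘ inclX ∘ (Π^tp_X̲̲ ⊆ Π^tp_X) ∘ refIso`.
([IUTchII] Def 2.3 (i), kurims p.67) [claim: Mochizuki2012, status: disputed] -/
theorem coverModelEmb_comp_incl :
    (coverModelEmb C μ hC hS hl hp2 hpl hζ hη ι T).comp T.incl =
      ((ι.toMonoidHom.comp M.inclX).comp C.Huu.subtype).comp (T.refIso.toMulEquiv.toMonoidHom : P →* C.Huu) := by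
  ext x
  change ι (M.inclX (T.plainIso (T.incl x)).1) = ι (M.inclX (T.refIso x).1)
  rw [T.plainIso_incl]
  rfl

omit [IsTopologicalGroup Q] in
/-- The range of `emb ∘ incl` of the construction is `ι(inclX Π^tp_X̲̲)` (`refIso` is onto).
([IUTchII] Def 2.3 (i), kurims p.67) [claim: Mochizuki2012, status: disputed] -/
theorem range_coverModelEmb_comp_incl :
    ((coverModelEmb C μ hC hS hl hp2 hpl hζ hη ι T).comp T.incl).range = (C.Huu.map M.inclX).map ι.toMonoidHom := by
  rw [coverModelEmb_comp_incl, MonoidHom.range_comp, MonoidHom.range_eq_top.mpr T.refIso.surjective,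
    ← MonoidHom.range_eq_map, MonoidHom.range_comp, Subgroup.range_subtype, Subgroup.map_map]

/-- **`Π^±_v = ι(inclX Π^tp_X̲)`** for `ofCoverModel`. ([IUTchII] Def 2.3 (i), kurims p.67) [claim: Mochizuki2012, status: disputed] -/
theorem piPM_ofCoverModel :
    (ofCoverModel e C μ hC hS hl hp2 hpl hζ hη ι hι hinj Φ hΦ hΦK hZ hN T).piPM =
      ((M.GtpXu l).map M.inclX).map ι.toMonoidHom :=
  range_coverModelEmb C μ hC hS hl hp2 hpl hζ hη ι T

/-- **`Π_v = ι(inclX Π^tp_X̲̲)`** for `ofCoverModel`. ([IUTchII] Def 2.3 (i), kurims p.67) [claim: Mochizuki2012, status: disputed] -/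
theorem piV_ofCoverModel :
    (ofCoverModel e C μ hC hS hl hp2 hpl hζ hη ι hι hinj Φ hΦ hΦK hZ hN T).piV =
      (C.Huu.map M.inclX).map ι.toMonoidHom :=
  range_coverModelEmb_comp_incl C μ hC hS hl hp2 hpl hζ hη ι T

/-- **`Δ̂^cor_v = Ker Φ`** for `ofCoverModel`. ([IUTchII] Def 2.3 (i), kurims p.67) [claim: Mochizuki2012, status: disputed] -/
theorem deltaCorHat_ofCoverModel :
    (ofCoverModel e C μ hC hS hl hp2 hpl hζ hη ι hι hinj Φ hΦ hΦK hZ hN T).deltaCorHat = Φ.ker :=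
  ker_coverModelAug C μ hC hS hl hp2 hpl hζ hη Φ hΦK

/-- **`Π̂^±_v = cl(Π^±_v)` and `Π̂_v = cl(Π_v)`** for `ofCoverModel` (print: "`Π̂` … profinite completion", realised as closure in `Π̂^cor_v`).
([IUTchII] Def 2.3 (i), kurims p.67) [claim: Mochizuki2012, status: disputed] -/
theorem pmHat_hat_eq_closure_ofCoverModel :
    (ofCoverModel e C μ hC hS hl hp2 hpl hζ hη ι hι hinj Φ hΦ hΦK hZ hN T).pmHat =
        (ofCoverModel e C μ hC hS hl hp2 hpl hζ hη ι hι hinj Φ hΦ hΦK hZ hN T).piPM.topologicalClosure ∧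
      (ofCoverModel e C μ hC hS hl hp2 hpl hζ hη ι hι hinj Φ hΦ hΦK hZ hN T).hat =
        (ofCoverModel e C μ hC hS hl hp2 hpl hζ hη ι hι hinj Φ hΦ hΦK hZ hN T).piV.topologicalClosure := by
  rw [piPM_ofCoverModel, piV_ofCoverModel]
  exact ⟨rfl, rfl⟩

/-- **`Π^±_v ∩ Δ̂^cor_v = ι(inclX Δ^tp_X̲)`-type bookkeeping: `Π_v ≤ Π^±_v ≤ Π^cor_v = ι(Π^tp_C)`** for `ofCoverModel`.
([IUTchII] Def 2.3 (i), kurims p.67) [claim: Mochizuki2012, status: disputed] -/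
theorem piV_le_piPM_le_cor_ofCoverModel :
    (ofCoverModel e C μ hC hS hl hp2 hpl hζ hη ι hι hinj Φ hΦ hΦK hZ hN T).piV ≤
        (ofCoverModel e C μ hC hS hl hp2 hpl hζ hη ι hι hinj Φ hΦ hΦK hZ hN T).piPM ∧
      (ofCoverModel e C μ hC hS hl hp2 hpl hζ hη ι hι hinj Φ hΦ hΦK hZ hN T).piPM ≤
        (ofCoverModel e C μ hC hS hl hp2 hpl hζ hη ι hι hinj Φ hΦ hΦK hZ hN T).cor := by
  rw [piPM_ofCoverModel, piV_ofCoverModel, (ofCoverModel_fields e C μ hC hS hl hp2 hpl hζ hη ι hι hinj Φ hΦ hΦK hZ hN T).2.1,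
    MonoidHom.range_eq_map]
  exact ⟨Subgroup.map_mono (Subgroup.map_mono C.Huu_le_GtpXu), Subgroup.map_mono le_top⟩

/-! ### The tower of record `ofPiCHat` -/

/-- **`Π^±_v`, `Π_v`, `Δ̂^cor_v` of the tower of record** inside abc-iut-L2-d3's `Π_C`: `toPiCHat(inclX Π^tp_X̲)`, `toPiCHat(inclX Π^tp_X̲̲)`,
`Ker piCData.aug`; and `Π̂^±_v = cl Π^±_v`, `Π̂_v = cl Π_v`.  ([IUTchII] Def 2.3 (i), kurims p.67) [claim: Mochizuki2012, status: disputed] -/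
theorem ofPiCHat_piPM_piV_deltaCorHat :
    (ofPiCHat e C μ hC hS hl hp2 hpl hζ hη hZ hN T).piPM = ((M.GtpXu l).map M.inclX).map e.toPiCHat.toMonoidHom ∧
    (ofPiCHat e C μ hC hS hl hp2 hpl hζ hη hZ hN T).piV = (C.Huu.map M.inclX).map e.toPiCHat.toMonoidHom ∧
    (ofPiCHat e C μ hC hS hl hp2 hpl hζ hη hZ hN T).deltaCorHat = e.piCData.aug.toMonoidHom.ker ∧
    (ofPiCHat e C μ hC hS hl hp2 hpl hζ hη hZ hN T).pmHat = (ofPiCHat e C μ hC hS hl hp2 hpl hζ hη hZ hN T).piPM.topologicalClosure ∧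
    (ofPiCHat e C μ hC hS hl hp2 hpl hζ hη hZ hN T).hat = (ofPiCHat e C μ hC hS hl hp2 hpl hζ hη hZ hN T).piV.topologicalClosure :=
  ⟨piPM_ofCoverModel e C μ hC hS hl hp2 hpl hζ hη _ _ _ _ _ _ hZ hN T,
    piV_ofCoverModel e C μ hC hS hl hp2 hpl hζ hη _ _ _ _ _ _ hZ hN T,
    deltaCorHat_ofCoverModel e C μ hC hS hl hp2 hpl hζ hη _ _ _ _ _ _ hZ hN T,
    (pmHat_hat_eq_closure_ofCoverModel e C μ hC hS hl hp2 hpl hζ hη _ _ _ _ _ _ hZ hN T).1,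
    (pmHat_hat_eq_closure_ofCoverModel e C μ hC hS hl hp2 hpl hζ hη _ _ _ _ _ _ hZ hN T).2⟩

end PlusMinusTower

end Literature.IUT.HodgeArakelov
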